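import Summits.Ventures.CertifiedManyBodySolver.Rows.ChainMarginalNodes
import Summits.Ventures.CertifiedManyBodySolver.Transport.ChainWindowParticleHoleRows

/-!
# Row predicates for op-08's `tl_marginal` ENT nodes issued WITH the symmetry identification `G = ⟨spin flip, reflection⟩`,
# and the solver-free EDGE to the `G`-free node by group averaging

HONEST FRAMING: first certified bounds; not a superconductivity verdict; every number certified or labelled float.

WHAT THIS FILE IS (speedrun cell sr-mbsolver, LIT team lit-1 gen-7; LEAD r118 (c) "STAGE 3: the window-level G-averaging
transport, kind-agnostic"). op-08's `tl_marginal` problem files (`code/oplayer/tl_marginal.py`) identify the entries of the window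
density matrix `ρ_k` under the group `G` generated by the signed Fock permutations `spin_flip`, `reflection` (and, at half filling
only, `particle_hole_bipartite` — the sibling predicate `EntTLMChainSymPHNode U n lo` of §D, with the third antecedent
`U_PH ρ U_PHᴴ = ρ`, `U_PH = phOp n = ⨂_x uPH((−1)^{x+1})`, `Transport/ChainWindowParticleHole[Rows]`) of `code/oplayer/fockspace.py`:
the SDP's variables are `G`-orbits of entries, i.e. its feasible set is the `G`-INVARIANT feasible set of the `G`-free problem. A
dual certificate of such a file therefore proves the bound ONLY for `G`-invariant feasible `ρ`; this file names that hypothesis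
shape — `EntTLMChainSymNode U n ν lo` = the binders of `EntTLMChainNode U n ν lo` VERBATIM plus the two invariance antecedents
`U_SF ρ U_SFᴴ = ρ` (`U_SF = ⨂_x uSpinFlip`, `Transport/ChainWindowSpinFlip`) and `U_R ρ U_Rᴴ = ρ` (`U_R = reflectionOp n = S·P·V`,
`Transport/ChainWindowReflectionRows`; both are fockspace's matrices in the tree's occupation basis) — and proves the EDGE
`EntTLMChainSymNode U n ν lo → EntTLMChainNode U n ν lo` by GROUP AVERAGING: given any feasible `ρ`, the successive midpoints
`ρ₁ = ½(ρ + U_SF ρ U_SFᴴ)`, `ρ₂ = ½(ρ₁ + W ρ₁ Wᴴ)` (`W = P·V`, the sign-free part of `U_R`; the sector sign `S` acts trivially on the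
sector-block-diagonal feasible set) are feasible (every row is convex and invariant under both symmetries — positivity, trace,
local translation invariance, sector zeros, density, reality, `|ρ_{kk'}| ≤ 1`, and the entropy row by concavity of the conditional
entropy [LiebRuskai1973] and unitary/relabelling invariance), `G`-invariant (`U_SF² = W² = 1`, `U_SF W = W U_SF`), and have the
SAME objective (`h_avg` is `G`-invariant); so the `G`-node's bound at `ρ₂` is the bound at `ρ`. At half filling a third
midpoint `ρ₃ = ½(ρ₂ + U_PH ρ₂ U_PHᴴ)` does the same for `EntTLMChainSymPHNode U n lo → EntTLMChainNode U n 1 lo` (the density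
row goes to `2 − ν`, the objective shifts by `(U/2)·avg(2 − n_x − n_{x+1})`, which vanishes because every site of an LTI window
state at filling `1` has density `1`; `U_PH² = ±1`, `U_SF U_PH = ±U_PH U_SF`, and `W U_PH Wᴴ = ±Π^{0,1} U_PH` with the parity `Π`
trivial on the sector-block-diagonal feasible set). Consequently every cell of
`EntTLMChainNode` (`….m1EnergyLowerRow`, `….m1DopedEnergyLowerRow`, `….le_energyPerSite`) applies BY NAME to certificates
issued with `group_generators = ["spin_flip", "reflection"]` (any filling) or `["spin_flip", "reflection",
"particle_hole_bipartite"]` (half filling), with no `G`-free re-issue.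

NOTHING IS ASSERTED HERE: the node is a `def … : Prop`; it is instantiated only under `Certificates/`. No `sorry`, no new axiom,
no named fact. [cite: KullEtAl2024, §II.B, §VI.B] [cite: LiebRuskai1973, Theorem 1] [cite: FawziFawziScalet2024Entropy, Theorem 4.1]
-/

noncomputable section

open Matrix Complex
open scoped ComplexOrder BigOperators
open Literature.Probability.LatticeModels
open Literature.MathematicalPhysics.QuantumLattice
open Literature.MathematicalPhysics.QuantumLattice.HubbardWave0
open Literature.MathematicalPhysics.QuantumLattice.ThermodynamicLimit
open Literature.MathematicalPhysics.QuantumLattice.JordanWigner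
open Literature.InformationTheory.Entropy (vonNeumannEntropy)
open Summit.Ventures.CertifiedManyBodySolver.Transport

namespace Summit.Ventures.CertifiedManyBodySolver

/-! ## §A  The node predicate (window `{-1, 0, …, n+1}`, `k = n + 3` sites, `t = 1`, `G = ⟨spin flip, reflection⟩`) -/

section Nodes

/-- **ENT node in `tl_marginal` form WITH the identification group `G = ⟨spin_flip, reflection⟩`** (op-08's problem files with
`group_generators = ["spin_flip", "reflection"]`, any filling `ν`): the binders of `EntTLMChainNode U n ν lo` verbatim —
positivity, trace one, local translation invariance, the `(N_↑, N_↓)` sector zeros, the site-averaged density row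
`Re tr(n_avg ρ) = ν`, real entries bounded by one, the entropy row — PLUS invariance of `ρ` under fockspace's spin flip
`⨂_x uSpinFlip` and reflection `reflectionOp n`; conclusion `lo ≤ Re tr(h_avg ρ)`. [cite: KullEtAl2024, §II.B, §VI.B] -/
def EntTLMChainSymNode (U : ℝ) (n : ℕ) (ν lo : ℚ) : Prop :=
  ∀ ρ : Op (PolySite (chainWindow (-1) ((n : ℤ) + 1))) 4, ρ.PosSemidef → ρ.trace = 1 →
    spinPartialTrace ((PolySite.affEmb 1 (unitVec 0) (chainWindow (-1) (n : ℤ))).trans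
        (PolySite.incl (affShiftSet_chainWindow_subset (-1) (n : ℤ)))) ρ =
      spinPartialTrace (PolySite.incl (chainWindow_mono_right (-1) (by omega : (n : ℤ) ≤ n + 1))) ρ →
    (∀ σ : Fin 2, ∀ k k' : TensorIndex (PolySite (chainWindow (-1) ((n : ℤ) + 1))) 4,
      (∑ x, if σ ∈ siteOcc (k x) then 1 else 0 : ℕ) ≠ (∑ x, if σ ∈ siteOcc (k' x) then 1 else 0 : ℕ) → ρ k k' = 0) →
    ((toSpin (tlmDensity n) * ρ).trace).re = ((ν : ℚ) : ℝ) →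
    (∀ k k' : TensorIndex (PolySite (chainWindow (-1) ((n : ℤ) + 1))) 4, starRingEnd ℂ (ρ k k') = ρ k k') →
    (∀ k k' : TensorIndex (PolySite (chainWindow (-1) ((n : ℤ) + 1))) 4, ‖ρ k k'‖ ≤ 1) →
    0 ≤ vonNeumannEntropy ρ -
      vonNeumannEntropy (spinPartialTrace (PolySite.incl (chainWindow_mono_right (-1) (by omega : (n : ℤ) ≤ n + 1))) ρ) →
    productOp (fun _ => uSpinFlip) * ρ * (productOp (fun _ => uSpinFlip))ᴴ = ρ →
    reflectionOp n * ρ * (reflectionOp n)ᴴ = ρ →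
    ((lo : ℚ) : ℝ) ≤ ((toSpin (tlmObjective 1 U n) * ρ).trace).re

end Nodes

/-! ## §B  The group-averaging edge `EntTLMChainSymNode → EntTLMChainNode` -/

section Edges

variable {U : ℝ} {n : ℕ} {ν lo lo' : ℚ}

/-- A node survives a SMALLER slot `lo' ≤ lo`. -/
theorem EntTLMChainSymNode.mono (h : EntTLMChainSymNode U n ν lo) (hlo : lo' ≤ lo) : EntTLMChainSymNode U n ν lo' :=
  fun ρ h1 h2 h3 h4 h5 h6 h7 h8 h9 h10 => le_trans (by exact_mod_cast hlo) (h ρ h1 h2 h3 h4 h5 h6 h7 h8 h9 h10)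

/-- A `G`-free certificate is a `G`-certificate: the `G`-node has two MORE antecedents. -/
theorem EntTLMChainNode.entTLMChainSymNode (h : EntTLMChainNode U n ν lo) : EntTLMChainSymNode U n ν lo :=
  fun ρ h1 h2 h3 h4 h5 h6 h7 h8 _ _ => h ρ h1 h2 h3 h4 h5 h6 h7 h8

/-- **THE GROUP-AVERAGING EDGE.** A bound certified for the `G = ⟨spin flip, reflection⟩`-identified `tl_marginal` ENT problem is a
bound for the `G`-free problem: `EntTLMChainSymNode U n ν lo → EntTLMChainNode U n ν lo`. Proof: average a feasible `ρ` over the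
spin flip, then over the reflection; every row is convex and symmetric, the objective is invariant.
[cite: KullEtAl2024, §II.B, §VI.B] [cite: LiebRuskai1973, Theorem 1] [cite: FawziFawziScalet2024Entropy, Theorem 4.1] -/
theorem EntTLMChainSymNode.entTLMChainNode (h : EntTLMChainSymNode U n ν lo) : EntTLMChainNode U n ν lo := by
  intro ρ hpos htr hlti hsec hdens hreal _ hent
  -- Step 1: the spin-flip average `ρ₁ = ½(ρ + U ρ Uᴴ)`
  set F : Op (PolySite (chainWindow (-1) ((n : ℤ) + 1))) 4 := productOp (fun _ => uSpinFlip) with hF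
  have hFF : Fᴴ * F = 1 := spinFlip_conjTranspose_mul_self
  have pos' : (F * ρ * Fᴴ).PosSemidef := conj_posSemidef F hpos
  have tr' : (F * ρ * Fᴴ).trace = 1 := by rw [conj_trace hFF]; exact htr
  have lti' := spinFlip_ltiRow n hlti
  have sec' := fun σ k k' hk => spinFlip_sectorRow hsec σ k k' hk
  have dens' := spinFlip_densityRow n hdens
  have real' := fun k k' => spinFlip_realRow hreal k k'
  have ent' := spinFlip_entropyRow n hpos hent
  set ρ₁ : Op (PolySite (chainWindow (-1) ((n : ℤ) + 1))) 4 := (2 : ℂ)⁻¹ • (ρ + F * ρ * Fᴴ) with hρ₁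
  have pos₁ : ρ₁.PosSemidef := posSemidef_midpoint hpos pos'
  have tr₁ : ρ₁.trace = 1 := trace_midpoint htr tr'
  have lti₁ : spinPartialTrace ((PolySite.affEmb 1 (unitVec 0) (chainWindow (-1) (n : ℤ))).trans
        (PolySite.incl (affShiftSet_chainWindow_subset (-1) (n : ℤ)))) ρ₁ =
      spinPartialTrace (PolySite.incl (chainWindow_mono_right (-1) (by omega : (n : ℤ) ≤ n + 1))) ρ₁ :=
    linearRow_midpoint _ _ hlti lti'
  have sec₁ : ∀ σ : Fin 2, ∀ k k' : TensorIndex (PolySite (chainWindow (-1) ((n : ℤ) + 1))) 4,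
      (∑ x, if σ ∈ siteOcc (k x) then 1 else 0 : ℕ) ≠ (∑ x, if σ ∈ siteOcc (k' x) then 1 else 0 : ℕ) → ρ₁ k k' = 0 :=
    fun σ k k' hk => apply_midpoint_eq_zero (hsec σ k k' hk) (sec' σ k k' hk)
  have dens₁ : ((toSpin (tlmDensity n) * ρ₁).trace).re = ((ν : ℚ) : ℝ) := re_trace_mul_midpoint _ hdens dens'
  have real₁ : ∀ k k', starRingEnd ℂ (ρ₁ k k') = ρ₁ k k' := fun k k' => conj_apply_midpoint hreal real' k k'
  have ent₁ := chainWindow_entropyRow_midpoint n hpos pos' htr tr' hent ent'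
  have inv₁ : F * ρ₁ * Fᴴ = ρ₁ := conj_midpoint_self F ρ (spinFlip_sq_conj ρ)
  have obj₁ : ((toSpin (tlmObjective 1 U n) * ρ₁).trace).re = ((toSpin (tlmObjective 1 U n) * ρ).trace).re :=
    re_trace_mul_midpoint _ rfl (spinFlip_objective n 1 U ρ)
  -- Step 2: the reflection average `ρ₂ = ½(ρ₁ + W ρ₁ Wᴴ)`, `W = P · V`
  set W : Op (PolySite (chainWindow (-1) ((n : ℤ) + 1))) 4 := reflectPV n with hW
  have hWW : Wᴴ * W = 1 := reflectPV_conjTranspose_mul_self n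
  have pos₁' : (W * ρ₁ * Wᴴ).PosSemidef := conj_posSemidef W pos₁
  have tr₁' : (W * ρ₁ * Wᴴ).trace = 1 := by rw [conj_trace hWW]; exact tr₁
  have lti₁' := reflectPV_ltiRow n lti₁
  have sec₁' := fun σ k k' hk => reflectPV_sectorRow n sec₁ σ k k' hk
  have dens₁' := reflectPV_densityRow n dens₁
  have real₁' := fun k k' => reflectPV_realRow n real₁ k k'
  have ent₁' := reflectPV_entropyRow n pos₁ lti₁ ent₁
  set ρ₂ : Op (PolySite (chainWindow (-1) ((n : ℤ) + 1))) 4 := (2 : ℂ)⁻¹ • (ρ₁ + W * ρ₁ * Wᴴ) with hρ₂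
  have pos₂ : ρ₂.PosSemidef := posSemidef_midpoint pos₁ pos₁'
  have tr₂ : ρ₂.trace = 1 := trace_midpoint tr₁ tr₁'
  have lti₂ : spinPartialTrace ((PolySite.affEmb 1 (unitVec 0) (chainWindow (-1) (n : ℤ))).trans
        (PolySite.incl (affShiftSet_chainWindow_subset (-1) (n : ℤ)))) ρ₂ =
      spinPartialTrace (PolySite.incl (chainWindow_mono_right (-1) (by omega : (n : ℤ) ≤ n + 1))) ρ₂ :=
    linearRow_midpoint _ _ lti₁ lti₁'
  have sec₂ : ∀ σ : Fin 2, ∀ k k' : TensorIndex (PolySite (chainWindow (-1) ((n : ℤ) + 1))) 4,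
      (∑ x, if σ ∈ siteOcc (k x) then 1 else 0 : ℕ) ≠ (∑ x, if σ ∈ siteOcc (k' x) then 1 else 0 : ℕ) → ρ₂ k k' = 0 :=
    fun σ k k' hk => apply_midpoint_eq_zero (sec₁ σ k k' hk) (sec₁' σ k k' hk)
  have dens₂ : ((toSpin (tlmDensity n) * ρ₂).trace).re = ((ν : ℚ) : ℝ) := re_trace_mul_midpoint _ dens₁ dens₁'
  have real₂ : ∀ k k', starRingEnd ℂ (ρ₂ k k') = ρ₂ k k' := fun k k' => conj_apply_midpoint real₁ real₁' k k'
  have norm₂ : ∀ k k', ‖ρ₂ k k'‖ ≤ 1 := norm_apply_midpoint_le_one pos₁ pos₁' tr₁ tr₁'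
  have ent₂ := chainWindow_entropyRow_midpoint n pos₁ pos₁' tr₁ tr₁' ent₁ ent₁'
  have invW₂ : W * ρ₂ * Wᴴ = ρ₂ := conj_midpoint_self W ρ₁ (reflectPV_sq_conj n ρ₁)
  have invF₂ : F * ρ₂ * Fᴴ = ρ₂ :=
    conj_midpoint_of_invariant W F ρ₁ inv₁
      (conj_conj_eq_of_commute_up_to_phase W F ρ₁ inv₁ 1 (by simp) (spinFlip_mul_reflectPV n))
  have invR₂ : reflectionOp n * ρ₂ * (reflectionOp n)ᴴ = ρ₂ := by
    rw [reflectionOp_conj_of_sectorRow n sec₂]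
    exact invW₂
  have obj₂ : ((toSpin (tlmObjective 1 U n) * ρ₂).trace).re = ((toSpin (tlmObjective 1 U n) * ρ₁).trace).re :=
    re_trace_mul_midpoint _ rfl (reflectPV_objective n 1 U ρ₁)
  -- Step 3: the `G`-node's bound at `ρ₂` is the bound at `ρ`
  have key := h ρ₂ pos₂ tr₂ lti₂ sec₂ dens₂ real₂ norm₂ ent₂ invF₂ invR₂
  rw [obj₂, obj₁] at key
  exact key

end Edges

/-! ## §C  Cells BY NAME (via the edge) -/

section Cells

variable {U : ℝ} {n : ℕ} {ν lo : ℚ} {p q : ℕ}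

/-- **`G`-identified ENT node at filling `1` ⇒ the M1 energy LOWER row `lo ≤ e₀(U)`** (`U ≥ 0`) — the cell of op-08's
`k = n + 3` ENT certificates issued WITH `group_generators = ["spin_flip", "reflection"]`. -/
theorem EntTLMChainSymNode.m1EnergyLowerRow (h : EntTLMChainSymNode U n 1 lo) (hU : 0 ≤ U) : M1EnergyLowerRow U lo :=
  h.entTLMChainNode.m1EnergyLowerRow hU

/-- `G`-identified ENT node at filling `ν = p/q` ⇒ the M1 doped energy LOWER row at filling `p/q`. -/
theorem EntTLMChainSymNode.m1DopedEnergyLowerRow (h : EntTLMChainSymNode U n ν lo) (hU : 0 ≤ U) (hq : 1 ≤ q) (hp : p ≤ 2 * q)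
    (hν : ((ν : ℚ) : ℝ) = (p : ℝ) / (q : ℝ)) : M1DopedEnergyLowerRow U p q lo :=
  h.entTLMChainNode.m1DopedEnergyLowerRow hU hq hp hν

/-- `G`-identified ENT node ⇒ the mean-energy ENT node at per-spin density `ν/2`. -/
theorem EntTLMChainSymNode.entChainNode (h : EntTLMChainSymNode U n (2 * ν) lo) : EntChainNode U n ν lo :=
  h.entTLMChainNode.entChainNode

variable {L : ℕ} [NeZero L] {nh : ℕ}

/-- RING form (NON-VACUITY bound): `lo ≤ E₀(ring L, N = 2nh)/L` when the node's filling is `ν = 2nh/L`. -/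
theorem EntTLMChainSymNode.le_energyPerSite (h : EntTLMChainSymNode U n ν lo) (hL : 3 ≤ L) (hn : nh ≤ L)
    (hInj : Set.InjOn (Torus.proj (d := 1) L) ↑(chainWindow (-1) (2 * (n : ℤ) + 3)))
    (hν : ((ν : ℚ) : ℝ) = 2 * (nh : ℝ) / (L : ℝ)) :
    ((lo : ℚ) : ℝ) ≤ energyPerSite (hubbardChain L) 1 U (2 * nh) :=
  h.entTLMChainNode.le_energyPerSite hL hn hInj hν

end Cells


/-! ## §D  Half filling: the node WITH `G = ⟨spin flip, reflection, particle–hole⟩` and its edge -/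

section HalfFilling

/-- **ENT node in `tl_marginal` form at HALF FILLING WITH the identification group `G = ⟨spin_flip, reflection,
particle_hole_bipartite⟩`** (op-08's problem files at filling `1` with all three `group_generators`): the binders of
`EntTLMChainNode U n 1 lo` verbatim PLUS invariance of `ρ` under fockspace's spin flip `⨂_x uSpinFlip`, reflection
`reflectionOp n`, and bipartite particle–hole map `phOp n`; conclusion `lo ≤ Re tr(h_avg ρ)`. [cite: KullEtAl2024, §II.B, §VI.B] -/
def EntTLMChainSymPHNode (U : ℝ) (n : ℕ) (lo : ℚ) : Prop :=
  ∀ ρ : Op (PolySite (chainWindow (-1) ((n : ℤ) + 1))) 4, ρ.PosSemidef → ρ.trace = 1 →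
    spinPartialTrace ((PolySite.affEmb 1 (unitVec 0) (chainWindow (-1) (n : ℤ))).trans
        (PolySite.incl (affShiftSet_chainWindow_subset (-1) (n : ℤ)))) ρ =
      spinPartialTrace (PolySite.incl (chainWindow_mono_right (-1) (by omega : (n : ℤ) ≤ n + 1))) ρ →
    (∀ σ : Fin 2, ∀ k k' : TensorIndex (PolySite (chainWindow (-1) ((n : ℤ) + 1))) 4,
      (∑ x, if σ ∈ siteOcc (k x) then 1 else 0 : ℕ) ≠ (∑ x, if σ ∈ siteOcc (k' x) then 1 else 0 : ℕ) → ρ k k' = 0) →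
    ((toSpin (tlmDensity n) * ρ).trace).re = ((1 : ℚ) : ℝ) →
    (∀ k k' : TensorIndex (PolySite (chainWindow (-1) ((n : ℤ) + 1))) 4, starRingEnd ℂ (ρ k k') = ρ k k') →
    (∀ k k' : TensorIndex (PolySite (chainWindow (-1) ((n : ℤ) + 1))) 4, ‖ρ k k'‖ ≤ 1) →
    0 ≤ vonNeumannEntropy ρ -
      vonNeumannEntropy (spinPartialTrace (PolySite.incl (chainWindow_mono_right (-1) (by omega : (n : ℤ) ≤ n + 1))) ρ) →
    productOp (fun _ => uSpinFlip) * ρ * (productOp (fun _ => uSpinFlip))ᴴ = ρ →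
    reflectionOp n * ρ * (reflectionOp n)ᴴ = ρ →
    phOp n * ρ * (phOp n)ᴴ = ρ →
    ((lo : ℚ) : ℝ) ≤ ((toSpin (tlmObjective 1 U n) * ρ).trace).re

variable {U : ℝ} {n : ℕ} {lo lo' : ℚ}

/-- A node survives a SMALLER slot `lo' ≤ lo`. -/
theorem EntTLMChainSymPHNode.mono (h : EntTLMChainSymPHNode U n lo) (hlo : lo' ≤ lo) : EntTLMChainSymPHNode U n lo' :=
  fun ρ h1 h2 h3 h4 h5 h6 h7 h8 h9 h10 h11 => le_trans (by exact_mod_cast hlo) (h ρ h1 h2 h3 h4 h5 h6 h7 h8 h9 h10 h11)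

/-- A `⟨spin flip, reflection⟩`-certificate at filling `1` is a `⟨spin flip, reflection, particle–hole⟩`-certificate. -/
theorem EntTLMChainSymNode.entTLMChainSymPHNode (h : EntTLMChainSymNode U n 1 lo) : EntTLMChainSymPHNode U n lo :=
  fun ρ h1 h2 h3 h4 h5 h6 h7 h8 h9 h10 _ => h ρ h1 h2 h3 h4 h5 h6 h7 h8 h9 h10

/-- **THE GROUP-AVERAGING EDGE AT HALF FILLING**: `EntTLMChainSymPHNode U n lo → EntTLMChainNode U n 1 lo`. Average a feasible
`ρ` over the spin flip, then the reflection, then the particle–hole map. [cite: KullEtAl2024, §II.B, §VI.B]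
[cite: LiebRuskai1973, Theorem 1] [cite: FawziFawziScalet2024Entropy, Theorem 4.1] [cite: LiebWu1968, eq. (4)] -/
theorem EntTLMChainSymPHNode.entTLMChainNode (h : EntTLMChainSymPHNode U n lo) : EntTLMChainNode U n 1 lo := by
  intro ρ hpos htr hlti hsec hdens hreal _ hent
  -- Step 1: the spin-flip average
  set F : Op (PolySite (chainWindow (-1) ((n : ℤ) + 1))) 4 := productOp (fun _ => uSpinFlip) with hF
  have hFF : Fᴴ * F = 1 := spinFlip_conjTranspose_mul_self
  have pos' : (F * ρ * Fᴴ).PosSemidef := conj_posSemidef F hpos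
  have tr' : (F * ρ * Fᴴ).trace = 1 := by rw [conj_trace hFF]; exact htr
  have lti' := spinFlip_ltiRow n hlti
  have sec' := fun σ k k' hk => spinFlip_sectorRow hsec σ k k' hk
  have dens' := spinFlip_densityRow n hdens
  have real' := fun k k' => spinFlip_realRow hreal k k'
  have ent' := spinFlip_entropyRow n hpos hent
  set ρ₁ : Op (PolySite (chainWindow (-1) ((n : ℤ) + 1))) 4 := (2 : ℂ)⁻¹ • (ρ + F * ρ * Fᴴ) with hρ₁
  have pos₁ : ρ₁.PosSemidef := posSemidef_midpoint hpos pos'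
  have tr₁ : ρ₁.trace = 1 := trace_midpoint htr tr'
  have lti₁ : spinPartialTrace ((PolySite.affEmb 1 (unitVec 0) (chainWindow (-1) (n : ℤ))).trans
        (PolySite.incl (affShiftSet_chainWindow_subset (-1) (n : ℤ)))) ρ₁ =
      spinPartialTrace (PolySite.incl (chainWindow_mono_right (-1) (by omega : (n : ℤ) ≤ n + 1))) ρ₁ :=
    linearRow_midpoint _ _ hlti lti'
  have sec₁ : ∀ σ : Fin 2, ∀ k k' : TensorIndex (PolySite (chainWindow (-1) ((n : ℤ) + 1))) 4,
      (∑ x, if σ ∈ siteOcc (k x) then 1 else 0 : ℕ) ≠ (∑ x, if σ ∈ siteOcc (k' x) then 1 else 0 : ℕ) → ρ₁ k k' = 0 :=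
    fun σ k k' hk => apply_midpoint_eq_zero (hsec σ k k' hk) (sec' σ k k' hk)
  have dens₁ : ((toSpin (tlmDensity n) * ρ₁).trace).re = ((1 : ℚ) : ℝ) := re_trace_mul_midpoint _ hdens dens'
  have real₁ : ∀ k k', starRingEnd ℂ (ρ₁ k k') = ρ₁ k k' := fun k k' => conj_apply_midpoint hreal real' k k'
  have ent₁ := chainWindow_entropyRow_midpoint n hpos pos' htr tr' hent ent'
  have inv₁ : F * ρ₁ * Fᴴ = ρ₁ := conj_midpoint_self F ρ (spinFlip_sq_conj ρ)
  have obj₁ : ((toSpin (tlmObjective 1 U n) * ρ₁).trace).re = ((toSpin (tlmObjective 1 U n) * ρ).trace).re :=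
    re_trace_mul_midpoint _ rfl (spinFlip_objective n 1 U ρ)
  -- Step 2: the reflection average
  set W : Op (PolySite (chainWindow (-1) ((n : ℤ) + 1))) 4 := reflectPV n with hW
  have hWW : Wᴴ * W = 1 := reflectPV_conjTranspose_mul_self n
  have pos₁' : (W * ρ₁ * Wᴴ).PosSemidef := conj_posSemidef W pos₁
  have tr₁' : (W * ρ₁ * Wᴴ).trace = 1 := by rw [conj_trace hWW]; exact tr₁
  have lti₁' := reflectPV_ltiRow n lti₁
  have sec₁' := fun σ k k' hk => reflectPV_sectorRow n sec₁ σ k k' hk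
  have dens₁' := reflectPV_densityRow n dens₁
  have real₁' := fun k k' => reflectPV_realRow n real₁ k k'
  have ent₁' := reflectPV_entropyRow n pos₁ lti₁ ent₁
  set ρ₂ : Op (PolySite (chainWindow (-1) ((n : ℤ) + 1))) 4 := (2 : ℂ)⁻¹ • (ρ₁ + W * ρ₁ * Wᴴ) with hρ₂
  have pos₂ : ρ₂.PosSemidef := posSemidef_midpoint pos₁ pos₁'
  have tr₂ : ρ₂.trace = 1 := trace_midpoint tr₁ tr₁'
  have lti₂ : spinPartialTrace ((PolySite.affEmb 1 (unitVec 0) (chainWindow (-1) (n : ℤ))).trans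
        (PolySite.incl (affShiftSet_chainWindow_subset (-1) (n : ℤ)))) ρ₂ =
      spinPartialTrace (PolySite.incl (chainWindow_mono_right (-1) (by omega : (n : ℤ) ≤ n + 1))) ρ₂ :=
    linearRow_midpoint _ _ lti₁ lti₁'
  have sec₂ : ∀ σ : Fin 2, ∀ k k' : TensorIndex (PolySite (chainWindow (-1) ((n : ℤ) + 1))) 4,
      (∑ x, if σ ∈ siteOcc (k x) then 1 else 0 : ℕ) ≠ (∑ x, if σ ∈ siteOcc (k' x) then 1 else 0 : ℕ) → ρ₂ k k' = 0 :=
    fun σ k k' hk => apply_midpoint_eq_zero (sec₁ σ k k' hk) (sec₁' σ k k' hk)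
  have dens₂ : ((toSpin (tlmDensity n) * ρ₂).trace).re = ((1 : ℚ) : ℝ) := re_trace_mul_midpoint _ dens₁ dens₁'
  have real₂ : ∀ k k', starRingEnd ℂ (ρ₂ k k') = ρ₂ k k' := fun k k' => conj_apply_midpoint real₁ real₁' k k'
  have ent₂ := chainWindow_entropyRow_midpoint n pos₁ pos₁' tr₁ tr₁' ent₁ ent₁'
  have invW₂ : W * ρ₂ * Wᴴ = ρ₂ := conj_midpoint_self W ρ₁ (reflectPV_sq_conj n ρ₁)
  have invF₂ : F * ρ₂ * Fᴴ = ρ₂ :=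
    conj_midpoint_of_invariant W F ρ₁ inv₁
      (conj_conj_eq_of_commute_up_to_phase W F ρ₁ inv₁ 1 (by simp) (spinFlip_mul_reflectPV n))
  have obj₂ : ((toSpin (tlmObjective 1 U n) * ρ₂).trace).re = ((toSpin (tlmObjective 1 U n) * ρ₁).trace).re :=
    re_trace_mul_midpoint _ rfl (reflectPV_objective n 1 U ρ₁)
  -- Step 3: the particle–hole average `ρ₃ = ½(ρ₂ + P ρ₂ Pᴴ)`, `P = phOp n`
  set P : Op (PolySite (chainWindow (-1) ((n : ℤ) + 1))) 4 := phOp n with hP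
  have hPP : Pᴴ * P = 1 := phOp_conjTranspose_mul_self n
  have pos₂' : (P * ρ₂ * Pᴴ).PosSemidef := conj_posSemidef P pos₂
  have tr₂' : (P * ρ₂ * Pᴴ).trace = 1 := by rw [conj_trace hPP]; exact tr₂
  have lti₂' := phOp_ltiRow n sec₂ lti₂
  have sec₂' := fun σ k k' hk => phOp_sectorRow n sec₂ σ k k' hk
  have dens₂' := phOp_densityRow n tr₂ dens₂
  have real₂' := fun k k' => phOp_realRow n real₂ k k'
  have ent₂' := phOp_entropyRow n pos₂ ent₂
  set ρ₃ : Op (PolySite (chainWindow (-1) ((n : ℤ) + 1))) 4 := (2 : ℂ)⁻¹ • (ρ₂ + P * ρ₂ * Pᴴ) with hρ₃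
  have pos₃ : ρ₃.PosSemidef := posSemidef_midpoint pos₂ pos₂'
  have tr₃ : ρ₃.trace = 1 := trace_midpoint tr₂ tr₂'
  have lti₃ : spinPartialTrace ((PolySite.affEmb 1 (unitVec 0) (chainWindow (-1) (n : ℤ))).trans
        (PolySite.incl (affShiftSet_chainWindow_subset (-1) (n : ℤ)))) ρ₃ =
      spinPartialTrace (PolySite.incl (chainWindow_mono_right (-1) (by omega : (n : ℤ) ≤ n + 1))) ρ₃ :=
    linearRow_midpoint _ _ lti₂ lti₂'
  have sec₃ : ∀ σ : Fin 2, ∀ k k' : TensorIndex (PolySite (chainWindow (-1) ((n : ℤ) + 1))) 4,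
      (∑ x, if σ ∈ siteOcc (k x) then 1 else 0 : ℕ) ≠ (∑ x, if σ ∈ siteOcc (k' x) then 1 else 0 : ℕ) → ρ₃ k k' = 0 :=
    fun σ k k' hk => apply_midpoint_eq_zero (sec₂ σ k k' hk) (sec₂' σ k k' hk)
  have dens₃ : ((toSpin (tlmDensity n) * ρ₃).trace).re = ((1 : ℚ) : ℝ) := re_trace_mul_midpoint _ dens₂ dens₂'
  have real₃ : ∀ k k', starRingEnd ℂ (ρ₃ k k') = ρ₃ k k' := fun k k' => conj_apply_midpoint real₂ real₂' k k'
  have norm₃ : ∀ k k', ‖ρ₃ k k'‖ ≤ 1 := norm_apply_midpoint_le_one pos₂ pos₂' tr₂ tr₂'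
  have ent₃ := chainWindow_entropyRow_midpoint n pos₂ pos₂' tr₂ tr₂' ent₂ ent₂'
  have invP₃ : P * ρ₃ * Pᴴ = ρ₃ := conj_midpoint_self P ρ₂ (phOp_sq_conj n ρ₂)
  have invF₃ : F * ρ₃ * Fᴴ = ρ₃ :=
    conj_midpoint_of_invariant P F ρ₂ invF₂
      (conj_conj_eq_of_commute_up_to_phase P F ρ₂ invF₂ ((-1 : ℂ) ^ (n + 3)) (neg_one_pow_mul_star _) (spinFlip_mul_phOp n))
  have invW₃ : W * ρ₃ * Wᴴ = ρ₃ := conj_midpoint_of_invariant P W ρ₂ invW₂ (reflectPV_conj_phOp_conj n sec₂ invW₂)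
  have invR₃ : reflectionOp n * ρ₃ * (reflectionOp n)ᴴ = ρ₃ := by
    rw [reflectionOp_conj_of_sectorRow n sec₃]
    exact invW₃
  have obj₃ : ((toSpin (tlmObjective 1 U n) * ρ₃).trace).re = ((toSpin (tlmObjective 1 U n) * ρ₂).trace).re :=
    re_trace_mul_midpoint _ rfl (phOp_objective n 1 U tr₂ lti₂ dens₂)
  -- Step 4: the `G`-node's bound at `ρ₃` is the bound at `ρ`
  have key := h ρ₃ pos₃ tr₃ lti₃ sec₃ dens₃ real₃ norm₃ ent₃ invF₃ invR₃ invP₃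
  rw [obj₃, obj₂, obj₁] at key
  exact key

/-- **Half-filling `G`-identified ENT node ⇒ the M1 energy LOWER row `lo ≤ e₀(U)`** (`U ≥ 0`) — the cell of op-08's
`k = n + 3` ENT certificates issued WITH `group_generators = ["spin_flip", "reflection", "particle_hole_bipartite"]`. -/
theorem EntTLMChainSymPHNode.m1EnergyLowerRow (h : EntTLMChainSymPHNode U n lo) (hU : 0 ≤ U) : M1EnergyLowerRow U lo :=
  h.entTLMChainNode.m1EnergyLowerRow hU

/-- Half-filling `G`-identified ENT node ⇒ the mean-energy ENT node at per-spin density `1/2`. -/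
theorem EntTLMChainSymPHNode.entChainNode (h : EntTLMChainSymPHNode U n lo) : EntChainNode U n (1 / 2) lo :=
  EntTLMChainNode.entChainNode (by rw [show (2 : ℚ) * (1 / 2) = 1 by norm_num]; exact h.entTLMChainNode)

variable {L : ℕ} [NeZero L] {nh : ℕ}

/-- RING form (NON-VACUITY bound): `lo ≤ E₀(ring L, N = 2nh)/L` when `2nh = L` (half filling). -/
theorem EntTLMChainSymPHNode.le_energyPerSite (h : EntTLMChainSymPHNode U n lo) (hL : 3 ≤ L) (hn : nh ≤ L)
    (hInj : Set.InjOn (Torus.proj (d := 1) L) ↑(chainWindow (-1) (2 * (n : ℤ) + 3)))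
    (hν : (((1 : ℚ) : ℚ) : ℝ) = 2 * (nh : ℝ) / (L : ℝ)) :
    ((lo : ℚ) : ℝ) ≤ energyPerSite (hubbardChain L) 1 U (2 * nh) :=
  h.entTLMChainNode.le_energyPerSite hL hn hInj hν

end HalfFilling

end Summit.Ventures.CertifiedManyBodySolver
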